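import Summits.BirchSwinnertonDyer.BirchSwinnertonDyer.Theorems.ByReductionTypeAtTwoRankOneAtTwoBigImageOddLocalFklAssembly
import Summits.BirchSwinnertonDyer.BirchSwinnertonDyer.Theorems.ByReductionTypeAtTwoRankOneAtTwoBigImageOddLocalFklTwistParity
import Literature.NumberTheory.EllipticCurves.GrossZagierRationalPointProofs
import HarnessLib

/-!
# Line `fkl` of crux `RankOneAtTwoBigImageOddLocal` (stmt-BirchSwinnertonDyer-23715, route ByReductionTypeAtTwo):
# ASSEMBLY FROM PRIMARY PRINTED FACTS — Gross–Zagier I.(7.3) replaced by {BCDT parametrisation, Hoffstein–Luo 1997, GZ86 V.(2.1)}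

Lead prover seat `bsd-line-fkl-p1` (g5), helper `--supports stmt-BirchSwinnertonDyer-23715`; integrates the width seat
`bsd-line-fkl-p2` g5's landing `Literature/…/GrossZagierRationalPointProofs.lean` (p607642:
`GrossZagier1986_thm_I_7_3_of_hoffsteinLuo : nonempty_modularParametrizationData → HoffsteinLuo1997_exists_twist_L_one_ne_zero →
(∀ N W K, gross_zagier N W K) → GrossZagier1986_thm_I_7_3`) into the assembly of `…FklAssembly` (p606641) and the half-slices of
`…FklTwistParity` (p607777).  After this file the citation stub of the skeleton (`stub_fklPub`, v9) is a conjunction of SEVEN PRIMARY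
printed facts of the tree — GZK (`rank_eq_analyticRank_of_analyticRank_le_one`), modularity (`exists_isNewformOf`, and BCDT's
parametrisation datum `nonempty_modularParametrizationData`), Abbes–Ullmo, Česnavičius 2018, Hoffstein–Luo 1997, Gross–Zagier 1986
V.(2.1) (`gross_zagier`) — and the six named OPEN residues.  Theorems only; no `def`, no `sorry`; conjecture / named-fact hypotheses
displayed, nothing discharged.  BSD is not proved by any of this.
-/

set_option autoImplicit false

noncomputable section

open scoped Classical MatrixGroups ModularForm

set_option linter.dupNamespace false

namespace Summit.BirchSwinnertonDyer.BirchSwinnertonDyer.Theorems.RankOneAtTwoFkl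

open CongruenceSubgroup WeierstrassCurve Literature.NumberTheory.EllipticCurves
  Literature.NumberTheory.EllipticCurves.ModularForms Summit.BirchSwinnertonDyer.Rank1Residual.F1Sign2

/-- **ASSEMBLY from primary printed facts: the crux `RankOneAtTwoBigImageOddLocal` BY NAME** from GZK, modularity (newform and
BCDT parametrisation datum), Abbes–Ullmo, Česnavičius 2018, Hoffstein–Luo 1997, Gross–Zagier 1986 V.(2.1), and the six named open
residues (HC, NV, HC_an, NV_an, `ManinOddAdditiveAtTwo`, `ShaAnTwoIntegralOnBigImageSlice`): Gross–Zagier I.(7.3) is derived by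
the width seat's `GrossZagier1986_thm_I_7_3_of_hoffsteinLuo`, then `rankOneAtTwoBigImageOddLocal_of_residues`.
[conjecture] inputs displayed; kernel glue. -/
theorem rankOneAtTwoBigImageOddLocal_of_residues_primary
    (hGZK : rank_eq_analyticRank_of_analyticRank_le_one) (hmod : exists_isNewformOf)
    (hAU : abbesUllmo_not_dvd_maninConstant_of_not_dvd_level) (hC : cesnavicius_not_two_dvd_maninConstant_of_two_dvd_level)
    (hmodP : nonempty_modularParametrizationData) (hHL : HoffsteinLuo1997_exists_twist_L_one_ne_zero)
    (hGZ : ∀ (N : ℕ) [NeZero N] (W : WeierstrassCurve ℚ) (K : Type) [Field K] [NumberField K], gross_zagier N W K)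
    (hHC : FirstLayerHigherCongruenceAtTwo) (hNV : FirstLayerNonVanishingAtTwo)
    (hHCan : AnalyticFirstLayerHigherCongruenceAtTwo) (hNVan : AnalyticFirstLayerNonVanishingAtTwo)
    (hManin : ManinOddAdditiveAtTwo) (hInt : ShaAnTwoIntegralOnBigImageSlice) :
    Summit.BirchSwinnertonDyer.BirchSwinnertonDyer.Theses.ByReductionTypeAtTwo.RankOneAtTwoBigImageOddLocal :=
  rankOneAtTwoBigImageOddLocal_of_residues hGZK hmod hAU hC (GrossZagier1986_thm_I_7_3_of_hoffsteinLuo hmodP hHL hGZ)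
    hHC hNV hHCan hNVan hManin hInt

/-- **Half-slice `{Ш(E)[2] = 0}` from primary printed facts** (level-two form, `…FklTwistParity.bsdp_two_on_shaTwoTrivial_of_levelTwo`):
GZK, modularity ×2, Abbes–Ullmo, Česnavičius, Hoffstein–Luo, GZ86 V.(2.1), (L2-NV) `LevelTwoTwistNonVanishingAtTwo`, (L2-HC_an)
`AnalyticLevelTwoTwistCongruenceAtTwo`, `ManinOddAdditiveAtTwo`, `ShaAnTwoIntegralOnBigImageSlice` ⟹ `BSDp W 2` for every slice
curve with `#Ш[2^∞] = 1`. [conjecture] inputs displayed; kernel glue. -/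
theorem bsdp_two_on_shaTwoTrivial_of_levelTwo_primary
    (hGZK : rank_eq_analyticRank_of_analyticRank_le_one) (hmod : exists_isNewformOf)
    (hAU : abbesUllmo_not_dvd_maninConstant_of_not_dvd_level) (hC : cesnavicius_not_two_dvd_maninConstant_of_two_dvd_level)
    (hmodP : nonempty_modularParametrizationData) (hHL : HoffsteinLuo1997_exists_twist_L_one_ne_zero)
    (hGZ : ∀ (N : ℕ) [NeZero N] (W : WeierstrassCurve ℚ) (K : Type) [Field K] [NumberField K], gross_zagier N W K)
    (hNV : LevelTwoTwistNonVanishingAtTwo) (hHCan : AnalyticLevelTwoTwistCongruenceAtTwo)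
    (hManin : ManinOddAdditiveAtTwo) (hInt : ShaAnTwoIntegralOnBigImageSlice) :
    ∀ (W : WeierstrassCurve ℚ) [W.IsElliptic] [W.IsGloballyMinimal], ¬ W.HasCM →
      (∀ n : ℕ, W.HasSurjectiveModNGaloisRep ((2 ^ n : ℕ) : ℤ)) → Odd W.torsionOrder → Odd W.tamagawaProduct →
      W.analyticRank = 1 → Nat.card (AddCommGroup.primaryComponent W.sha 2) = 1 → BSDp W 2 :=
  bsdp_two_on_shaTwoTrivial_of_levelTwo hGZK hmod hAU hC (GrossZagier1986_thm_I_7_3_of_hoffsteinLuo hmodP hHL hGZ)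
    hNV hHCan hManin hInt

/-- **Half-slice `{Ш_an(E) odd}` from primary printed facts** (level-two form, `…FklTwistParity.bsdp_two_on_shaAnUnit_of_levelTwo`):
GZK, modularity ×2, Abbes–Ullmo, Česnavičius, Hoffstein–Luo, GZ86 V.(2.1), (L2-HC) `LevelTwoTwistCongruenceAtTwo`, (L2-NV_an)
`AnalyticLevelTwoTwistNonVanishingAtTwo`, `ManinOddAdditiveAtTwo` ⟹ `BSDp W 2` for every slice curve whose `Ш_an` is a `2`-adic unit.
[conjecture] inputs displayed; kernel glue. -/
theorem bsdp_two_on_shaAnUnit_of_levelTwo_primary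
    (hGZK : rank_eq_analyticRank_of_analyticRank_le_one) (hmod : exists_isNewformOf)
    (hAU : abbesUllmo_not_dvd_maninConstant_of_not_dvd_level) (hC : cesnavicius_not_two_dvd_maninConstant_of_two_dvd_level)
    (hmodP : nonempty_modularParametrizationData) (hHL : HoffsteinLuo1997_exists_twist_L_one_ne_zero)
    (hGZ : ∀ (N : ℕ) [NeZero N] (W : WeierstrassCurve ℚ) (K : Type) [Field K] [NumberField K], gross_zagier N W K)
    (hHC : LevelTwoTwistCongruenceAtTwo) (hNVan : AnalyticLevelTwoTwistNonVanishingAtTwo)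
    (hManin : ManinOddAdditiveAtTwo) :
    ∀ (W : WeierstrassCurve ℚ) [W.IsElliptic] [W.IsGloballyMinimal], ¬ W.HasCM →
      (∀ n : ℕ, W.HasSurjectiveModNGaloisRep ((2 ^ n : ℕ) : ℤ)) → Odd W.torsionOrder → Odd W.tamagawaProduct →
      W.analyticRank = 1 → (∀ q : ℚ, shaAn W = (q : ℂ) → padicValRat 2 q = 0) → BSDp W 2 :=
  bsdp_two_on_shaAnUnit_of_levelTwo hGZK hmod hAU hC (GrossZagier1986_thm_I_7_3_of_hoffsteinLuo hmodP hHL hGZ)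
    hHC hNVan hManin

end Summit.BirchSwinnertonDyer.BirchSwinnertonDyer.Theorems.RankOneAtTwoFkl

end
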